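import Summits.QuantumFields.BalabanUV.T4Continuum.Support.DirichletDipCutoff

/-!
# `BalabanUV.T4Continuum.Support.DirichletDipCutoffAxis` — NE2 (node U1a) formalisation swarm, sub-row `T4-U1a.S-NE2-D1-DIRICHLET°`, supplier item
# «Δ1-SKELETON» (file 4): AXIS PROFILES — a function of the block coordinate and the offset along ONE axis whose in-block differences are
# bounded, which is continuous across the block faces and flat next to them, lifts to a lattice function with the same first ∕ second
# difference bounds along that axis and constant along the others; the height factor `hV` and the windows `W_κ` of the dips are such
# (unit b2b-balaban-t4-ne2-formalise-leaf-08, gen 7, file 4)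

HONEST FRAMING.  Rung (B)+1 bookkeeping at MODEL level, finite torus; pure lattice combinatorics; NE2 (U1a) is NOT proved by this file;
spine PROVED 0/9 unchanged; NOT infinite volume, NOT the mass gap, NOT Clay.  HONEST DEPENDENCY (verbatim): «continuum YM on T⁴ ⇐ BetaPertH ∧
nine spine estimates (0/9 proved); BetaPertH ⇐ (D1) ∧ (D4) ∧ CAP+tail; G-an2-4 gates asym, D1 and NE2/3/4.»

WHAT THIS FILE PROVES (0 sorry).  §1 [shape] `AxisSmooth n F L₁ L₂` for `F : ZMod m → ℕ → ℝ` (block coordinate, offset): in-block steps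
`≤ L₁`, in-block second differences `≤ L₂`, CROSS-FACE CONTINUITY `F (b+1) 0 = F b (n−1)`, FLAT ENDS `F b 1 = F b 0`, `F b (n−1) = F b (n−2)`;
the lift `liftA κ F x = F (blockOf x κ) (offsF x κ)` then satisfies **`liftA_step`** `|Φ(x+e_κ) − Φ x| ≤ L₁`, **`liftA_second`**
`|2Φ x − Φ(x+e_κ) − Φ(x−e_κ)| ≤ L₂` at EVERY site, `liftA_cross` (exact equality across a face) and is constant along every other axis.
§2 the dip pieces of file 3 are lifts: `hV = liftA μ (hVp (β μ))`, `W_κ = liftA κ (Wp (β κ))` with **`axisSmooth_hVp`** (`L₁ = lip1 R`, `L₂ = lip2 R`;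
needs `(1 : ZMod (M μ)) ≠ 0`, automatic for a `−μ`-exposed block) and **`axisSmooth_Wp`** (`2·lip1 R`, `2·lip2 R`; every `M_κ ≥ 1`), from the
plateau `q(0) = q(1) = q(2) = 1` and the far zeros `q(n−2) = q(n−1) = q(n) = 0` of `qprof R R` (`2 ≤ R`, `4R ≤ n`).  The consequences for the
smooth part `Gs` of a dip (`Gs_step`, `Gs_second`, `Gs_cross`) are drawn in the next file `DirichletDipSmoothPart`.

ABSOLUTE RULE (cell, verbatim): «No internally-minted statement may enter as a cited fact. Every hypothesis is either kernel-proved in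
this package or a verbatim quotation of a PUBLISHED theorem with page reference. The manuscript(s) under audit are NOT citable for
their own disputed steps — they are the thing under adjudication; programme-internal (2001/route/tribunal) claims are never citable.»
[folklore] lattice bookkeeping; one hypothesis STRUCTURE on data + data definitions; no `def … : Prop` fact.  NOT CLAIMED: the smoothness of
`psiS` (next file); NE2; NE3.
-/

noncomputable section

open scoped BigOperators
open Finset

namespace Summit.QuantumFields.BalabanUV.T4Continuum.DirichletDipCutoffAxis

open Literature.MathematicalPhysics.QuantumFieldTheory.Balaban1983to89.B5Prop11Plancherel (Tor fine unitVec)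
open Literature.MathematicalPhysics.QuantumFieldTheory.Balaban1983to89.B5Blocks16 (blockOf)
open Summit.QuantumFields.BalabanUV.T4Continuum.DirichletMonotoneCutoff (offsF blockOf_offsF_add_of_lt blockOf_offsF_add_of_eq
  blockOf_offsF_sub pred_pos)
open Summit.QuantumFields.BalabanUV.T4Continuum.ScaleProfile (qprof qprof_mem qprof_eq_one qprof_eq_zero lip1 lip2 lip1_nonneg lip2_nonneg
  qprof_step qprof_second' qprof_rev_step qprof_rev_second prod_mem)
open Summit.QuantumFields.BalabanUV.T4Continuum.DirichletDipCutoff (BotExp hV Wax Ptr Gs hV_mem Wax_mem Ptr_mem Gs_eq_of_botExp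
  Gs_eq_zero_of_not_botExp)

variable {d : ℕ} (n : ℕ) [NeZero n] (M : Fin d → ℕ) [hM : ∀ μ, NeZero (M μ)]

/-! ## §0 Coordinates of `b ± e_κ` -/

omit hM in
/-- `(b + e_κ) κ = b κ + 1`. [folklore] -/
theorem add_unitVec_self (b : Tor M) (κ : Fin d) : (b + unitVec M κ) κ = b κ + 1 := by
  simp [unitVec, Pi.add_apply, Pi.single_eq_same]

omit hM in
/-- `(b + e_κ) λ = b λ` for `λ ≠ κ`. [folklore] -/
theorem add_unitVec_ne (b : Tor M) {κ lam : Fin d} (h : lam ≠ κ) : (b + unitVec M κ) lam = b lam := by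
  simp [unitVec, Pi.add_apply, Pi.single_eq_of_ne h]

omit hM in
/-- `(b − e_κ) κ = b κ − 1`. [folklore] -/
theorem sub_unitVec_self (b : Tor M) (κ : Fin d) : (b - unitVec M κ) κ = b κ - 1 := by
  simp [unitVec, Pi.sub_apply, Pi.single_eq_same]

omit hM in
/-- `(b − e_κ) λ = b λ` for `λ ≠ κ`. [folklore] -/
theorem sub_unitVec_ne (b : Tor M) {κ lam : Fin d} (h : lam ≠ κ) : (b - unitVec M κ) lam = b lam := by
  simp [unitVec, Pi.sub_apply, Pi.single_eq_of_ne h]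

/-! ## §1 Axis profiles and their lifts -/

/-- [shape] **AXIS PROFILE**: `F b t` (block coordinate `b`, offset `t < n`) with in-block steps `≤ L₁`, in-block second differences `≤ L₂`,
continuous across the faces and flat next to them. [folklore] -/
structure AxisSmooth {m : ℕ} (F : ZMod m → ℕ → ℝ) (L₁ L₂ : ℝ) : Prop where
  L1_nonneg : 0 ≤ L₁
  L2_nonneg : 0 ≤ L₂
  step : ∀ b t, t + 1 < n → |F b (t + 1) - F b t| ≤ L₁
  second : ∀ b t, t + 2 < n → |2 * F b (t + 1) - F b (t + 2) - F b t| ≤ L₂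
  cross : ∀ b, F (b + 1) 0 = F b (n - 1)
  flat_lo : ∀ b, F b 1 = F b 0
  flat_hi : ∀ b, F b (n - 1) = F b (n - 2)

/-- the lift of an axis profile along `κ`: `Φ x = F (blockOf x κ) (offsF x κ)`. [folklore] -/
def liftA (κ : Fin d) (F : ZMod (M κ) → ℕ → ℝ) (x : Tor (fine n M)) : ℝ := F (blockOf n M x κ) (offsF n M x κ : ℕ)

section Lift

variable {n M} (κ : Fin d) (F : ZMod (M κ) → ℕ → ℝ)

/-- the lift is constant along every other axis (forward). [folklore] -/
theorem liftA_add_of_ne {lam : Fin d} (h : lam ≠ κ) (x : Tor (fine n M)) :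
    liftA n M κ F (x + unitVec (fine n M) lam) = liftA n M κ F x := by
  unfold liftA
  rcases Nat.lt_or_ge ((offsF n M x lam : ℕ) + 1) n with hlt | hge
  · obtain ⟨hb, ho⟩ := blockOf_offsF_add_of_lt n M x lam hlt
    rw [hb, ho, Function.update_of_ne (Ne.symm h)]
  · have heq : (offsF n M x lam : ℕ) + 1 = n := le_antisymm (offsF n M x lam).isLt hge
    obtain ⟨hb, ho⟩ := blockOf_offsF_add_of_eq n M x lam heq
    rw [hb, ho, Function.update_of_ne (Ne.symm h), add_unitVec_ne M _ (Ne.symm h)]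

/-- the lift is constant along every other axis (backward). [folklore] -/
theorem liftA_sub_of_ne {lam : Fin d} (h : lam ≠ κ) (x : Tor (fine n M)) :
    liftA n M κ F (x - unitVec (fine n M) lam) = liftA n M κ F x := by
  have := liftA_add_of_ne κ F h (x - unitVec (fine n M) lam)
  rw [sub_add_cancel] at this
  exact this.symm

variable {F} {L₁ L₂ : ℝ} (hF : AxisSmooth n F L₁ L₂) (hn3 : 3 ≤ n)
include hF

/-- **the lift across a face**: `Φ(x + e_κ) = Φ x` when `x` is on the last `κ`-layer of its block. [folklore] -/
theorem liftA_cross {x : Tor (fine n M)} (h : (offsF n M x κ : ℕ) + 1 = n) : liftA n M κ F (x + unitVec (fine n M) κ) = liftA n M κ F x := by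
  unfold liftA
  obtain ⟨hb, ho⟩ := blockOf_offsF_add_of_eq n M x κ h
  rw [hb, ho, Function.update_self, add_unitVec_self, Fin.val_zero, hF.cross, show n - 1 = (offsF n M x κ : ℕ) by omega]

/-- **first differences of the lift**: `|Φ(x + e_κ) − Φ x| ≤ L₁` at every site. [folklore] -/
theorem liftA_step (x : Tor (fine n M)) : |liftA n M κ F (x + unitVec (fine n M) κ) - liftA n M κ F x| ≤ L₁ := by
  rcases Nat.lt_or_ge ((offsF n M x κ : ℕ) + 1) n with hlt | hge
  · unfold liftA
    obtain ⟨hb, ho⟩ := blockOf_offsF_add_of_lt n M x κ hlt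
    rw [hb, ho, Function.update_self]
    exact hF.step _ _ hlt
  · have heq : (offsF n M x κ : ℕ) + 1 = n := le_antisymm (offsF n M x κ).isLt hge
    rw [liftA_cross κ hF heq, sub_self, abs_zero]; exact hF.L1_nonneg

include hn3 in
/-- **second differences of the lift**: `|2Φ x − Φ(x + e_κ) − Φ(x − e_κ)| ≤ L₂` at every site (at a face: cross-continuity + flat ends give `0`).
[folklore] -/
theorem liftA_second (x : Tor (fine n M)) :
    |2 * liftA n M κ F x - liftA n M κ F (x + unitVec (fine n M) κ) - liftA n M κ F (x - unitVec (fine n M) κ)| ≤ L₂ := by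
  set t := (offsF n M x κ : ℕ) with ht
  rcases blockOf_offsF_sub n M x κ with ⟨hne, hbm, hom, -⟩ | ⟨h0, hbm, hom, -⟩
  · -- `t ≥ 1`: the backward neighbour is in the same block at offset `t − 1`
    rcases Nat.lt_or_ge (t + 1) n with hlt | hge
    · -- interior triple
      unfold liftA
      obtain ⟨hb, ho⟩ := blockOf_offsF_add_of_lt n M x κ hlt
      rw [hb, ho, Function.update_self, hbm, hom]
      have := hF.second (blockOf n M x κ) (t - 1) (by omega)
      rw [show t - 1 + 1 = t by omega, show t - 1 + 2 = t + 1 by omega] at this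
      simpa [ht] using this
    · -- `t = n − 1`: forward neighbour across the face equals `Φ x`; backward at `n − 2` equals `Φ x` by flatness
      have heq : t + 1 = n := le_antisymm (offsF n M x κ).isLt hge
      rw [liftA_cross κ hF heq]
      have hback : liftA n M κ F (x - unitVec (fine n M) κ) = liftA n M κ F x := by
        unfold liftA; rw [hbm, hom, show t - 1 = n - 2 by omega, ← hF.flat_hi, show n - 1 = t by omega]
      rw [hback, show 2 * liftA n M κ F x - liftA n M κ F x - liftA n M κ F x = 0 by ring, abs_zero]; exact hF.L2_nonneg
  · -- `t = 0`: backward neighbour is the last layer of the block below; forward at offset `1` equals `Φ x` by flatness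
    have hlt : t + 1 < n := by omega
    have hfwd : liftA n M κ F (x + unitVec (fine n M) κ) = liftA n M κ F x := by
      unfold liftA
      obtain ⟨hb, ho⟩ := blockOf_offsF_add_of_lt n M x κ hlt
      rw [hb, ho, Function.update_self]
      show F _ ((offsF n M x κ : ℕ) + 1) = F _ (offsF n M x κ : ℕ)
      rw [h0]; exact hF.flat_lo _
    have hback : liftA n M κ F (x - unitVec (fine n M) κ) = liftA n M κ F x := by
      unfold liftA
      rw [hbm, hom, sub_unitVec_self, ← hF.cross, sub_add_cancel]
      show F _ 0 = F _ (offsF n M x κ : ℕ)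
      rw [h0]
    rw [hfwd, hback, show 2 * liftA n M κ F x - liftA n M κ F x - liftA n M κ F x = 0 by ring, abs_zero]; exact hF.L2_nonneg

end Lift

/-! ## §2 The height factor and the windows are lifts of axis profiles -/

section Pieces

variable {n M} (μ : Fin d) (R : ℕ)

/-- the pure height profile: `q(t)` on the layer `c`, `q(n − t)` on the layer `c − 1`, `0` elsewhere. [folklore] -/
def hVp {m : ℕ} (c b : ZMod m) (t : ℕ) : ℝ := if b = c then qprof R R t else if b = c - 1 then qprof R R (n - t) else 0

/-- the pure window profile: `1` on the range `c`, `q(t)` ∕ `q(n−1−t)` on the next ∕ previous range, `0` beyond. [folklore] -/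
def Wp {m : ℕ} (c b : ZMod m) (t : ℕ) : ℝ :=
  if b = c then 1 else (if b = c + 1 then qprof R R t else 0) + (if b = c - 1 then qprof R R (n - 1 - t) else 0)

/-- `hV` is the lift of `hVp` along `μ`. [folklore] -/
theorem hV_eq_liftA (β : Tor M) (x : Tor (fine n M)) : hV n M μ R β x = liftA n M μ (hVp (n := n) R (β μ)) x := rfl

/-- `W_κ` is the lift of `Wp` along `κ`. [folklore] -/
theorem Wax_eq_liftA (β : Tor M) (κ : Fin d) (x : Tor (fine n M)) : Wax n M R β κ x = liftA n M κ (Wp (n := n) R (β κ)) x := rfl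

variable {R} (hR : 2 ≤ R) (hn : 4 * R ≤ n)
include hR hn

omit [NeZero n] hM in
/-- plateau and far values of `q = qprof R R`: `q 0 = q 1 = q 2 = 1`, `q (n−2) = q (n−1) = q n = 0`. [folklore] -/
theorem q_values : qprof R R 0 = 1 ∧ qprof R R 1 = 1 ∧ qprof R R 2 = 1 ∧ qprof R R (n - 2) = 0 ∧ qprof R R (n - 1) = 0 ∧ qprof R R n = 0 :=
  ⟨qprof_eq_one R (by omega) (by omega), qprof_eq_one R (by omega) (by omega), qprof_eq_one R (by omega) hR,
    qprof_eq_zero hR R (by omega), qprof_eq_zero hR R (by omega), qprof_eq_zero hR R (by omega)⟩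

omit [NeZero n] hM in
/-- **the height profile is an axis profile** (`L₁ = lip1 R`, `L₂ = lip2 R`) whenever `1 ≠ 0` in `ZMod m` (the torus has at least two
layers along `μ`; automatic for a `−μ`-exposed block). [folklore] -/
theorem axisSmooth_hVp {m : ℕ} (h10 : (1 : ZMod m) ≠ 0) (c : ZMod m) : AxisSmooth n (hVp (n := n) R c) (lip1 R) (lip2 R) := by
  obtain ⟨q0, q1, q2, qn2, qn1, qn⟩ := q_values (n := n) hR hn
  have hcc : c - 1 ≠ c := fun h => h10 (by
    have := congrArg (fun z => c - z) h
    simpa using this)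
  refine ⟨lip1_nonneg hR, lip2_nonneg, fun b t ht => ?_, fun b t ht => ?_, fun b => ?_, fun b => ?_, fun b => ?_⟩
  · -- steps
    unfold hVp
    by_cases h1 : b = c
    · simp only [if_pos h1]; exact qprof_step hR R t
    · by_cases h2 : b = c - 1
      · simp only [if_neg h1, if_pos h2]
        have := qprof_rev_step hR R n t
        rwa [show n - (t + 1) = n - (t + 1) from rfl] at this
      · simp only [if_neg h1, if_neg h2, sub_self, abs_zero]; exact lip1_nonneg hR
  · -- second differences
    unfold hVp
    by_cases h1 : b = c
    · simp only [if_pos h1]; exact qprof_second' hR R t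
    · by_cases h2 : b = c - 1
      · simp only [if_neg h1, if_pos h2]
        have := qprof_rev_second hR R (K := n) (i := t) (by omega)
        rw [show 2 * qprof R R (n - (t + 1)) - qprof R R (n - (t + 2)) - qprof R R (n - t)
            = -(qprof R R (n - (t + 2)) - 2 * qprof R R (n - (t + 1)) + qprof R R (n - t)) by ring, abs_neg]
        exact this
      · simp only [if_neg h1, if_neg h2]; norm_num; exact lip2_nonneg
  · -- cross-face continuity `F (b+1) 0 = F b (n−1)`: both sides equal `[b = c − 1]` (using `c − 1 ≠ c`)
    have e2 : (b + 1 = c) ↔ (b = c - 1) := ⟨fun h => by rw [← h, add_sub_cancel_right], fun h => by rw [h, sub_add_cancel]⟩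
    have lhs : hVp (n := n) R c (b + 1) 0 = if b = c - 1 then 1 else 0 := by
      unfold hVp
      by_cases h : b + 1 = c
      · rw [if_pos h, if_pos (e2.1 h), q0]
      · rw [if_neg h, if_neg (fun h' => h (e2.2 h'))]
        split_ifs
        · rw [Nat.sub_zero, qn]
        · rfl
    have rhs : hVp (n := n) R c b (n - 1) = if b = c - 1 then 1 else 0 := by
      unfold hVp
      by_cases h : b = c
      · rw [if_pos h, qn1, if_neg (fun h' => hcc (by rw [← h', h]))]
      · rw [if_neg h]
        split_ifs
        · rw [show n - (n - 1) = 1 by omega, q1]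
        · rfl
    rw [lhs, rhs]
  · -- flat low end
    unfold hVp
    split_ifs
    · rw [q1, q0]
    · rw [qn1, Nat.sub_zero, qn]
    · rfl
  · -- flat high end
    unfold hVp
    split_ifs
    · rw [qn1, qn2]
    · rw [show n - (n - 1) = 1 by omega, show n - (n - 2) = 2 by omega, q1, q2]
    · rfl

omit [NeZero n] hM in
/-- **the window profile is an axis profile** (`L₁ = 2·lip1 R`, `L₂ = 2·lip2 R`), for every `m ≥ 0`. [folklore] -/
theorem axisSmooth_Wp {m : ℕ} (c : ZMod m) : AxisSmooth n (Wp (n := n) R c) (2 * lip1 R) (2 * lip2 R) := by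
  obtain ⟨q0, q1, q2, qn2, qn1, qn⟩ := q_values (n := n) hR hn
  have hl1 := lip1_nonneg hR
  have hl2 : 0 ≤ lip2 R := lip2_nonneg
  refine ⟨by positivity, by positivity, fun b t ht => ?_, fun b t ht => ?_, fun b => ?_, fun b => ?_, fun b => ?_⟩
  · unfold Wp
    by_cases h0 : b = c
    · simp only [if_pos h0, sub_self, abs_zero]; positivity
    · simp only [if_neg h0]
      have hA : |(if b = c + 1 then qprof R R (t + 1) else 0) - (if b = c + 1 then qprof R R t else 0)| ≤ lip1 R := by
        split_ifs
        · exact qprof_step hR R t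
        · rw [sub_self, abs_zero]; exact hl1
      have hB : |(if b = c - 1 then qprof R R (n - 1 - (t + 1)) else 0) - (if b = c - 1 then qprof R R (n - 1 - t) else 0)| ≤ lip1 R := by
        split_ifs
        · exact qprof_rev_step hR R (n - 1) t
        · rw [sub_self, abs_zero]; exact hl1
      calc |(if b = c + 1 then qprof R R (t + 1) else 0) + (if b = c - 1 then qprof R R (n - 1 - (t + 1)) else 0)
              - ((if b = c + 1 then qprof R R t else 0) + (if b = c - 1 then qprof R R (n - 1 - t) else 0))|
          = |((if b = c + 1 then qprof R R (t + 1) else 0) - (if b = c + 1 then qprof R R t else 0))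
              + ((if b = c - 1 then qprof R R (n - 1 - (t + 1)) else 0) - (if b = c - 1 then qprof R R (n - 1 - t) else 0))| := by ring_nf
        _ ≤ lip1 R + lip1 R := (abs_add_le _ _).trans (add_le_add hA hB)
        _ = 2 * lip1 R := by ring
  · unfold Wp
    by_cases h0 : b = c
    · simp only [if_pos h0]; norm_num; positivity
    · simp only [if_neg h0]
      have hA : |2 * (if b = c + 1 then qprof R R (t + 1) else 0) - (if b = c + 1 then qprof R R (t + 2) else 0)
          - (if b = c + 1 then qprof R R t else 0)| ≤ lip2 R := by
        split_ifs
        · exact qprof_second' hR R t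
        · norm_num; exact hl2
      have hB : |2 * (if b = c - 1 then qprof R R (n - 1 - (t + 1)) else 0) - (if b = c - 1 then qprof R R (n - 1 - (t + 2)) else 0)
          - (if b = c - 1 then qprof R R (n - 1 - t) else 0)| ≤ lip2 R := by
        split_ifs
        · have := qprof_rev_second hR R (K := n - 1) (i := t) (by omega)
          rw [show 2 * qprof R R (n - 1 - (t + 1)) - qprof R R (n - 1 - (t + 2)) - qprof R R (n - 1 - t)
              = -(qprof R R (n - 1 - (t + 2)) - 2 * qprof R R (n - 1 - (t + 1)) + qprof R R (n - 1 - t)) by ring, abs_neg]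
          exact this
        · norm_num; exact hl2
      calc |2 * ((if b = c + 1 then qprof R R (t + 1) else 0) + (if b = c - 1 then qprof R R (n - 1 - (t + 1)) else 0))
            - ((if b = c + 1 then qprof R R (t + 2) else 0) + (if b = c - 1 then qprof R R (n - 1 - (t + 2)) else 0))
            - ((if b = c + 1 then qprof R R t else 0) + (if b = c - 1 then qprof R R (n - 1 - t) else 0))|
          = |(2 * (if b = c + 1 then qprof R R (t + 1) else 0) - (if b = c + 1 then qprof R R (t + 2) else 0)
              - (if b = c + 1 then qprof R R t else 0))
            + (2 * (if b = c - 1 then qprof R R (n - 1 - (t + 1)) else 0) - (if b = c - 1 then qprof R R (n - 1 - (t + 2)) else 0)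
              - (if b = c - 1 then qprof R R (n - 1 - t) else 0))| := by ring_nf
        _ ≤ lip2 R + lip2 R := (abs_add_le _ _).trans (add_le_add hA hB)
        _ = 2 * lip2 R := by ring
  · -- cross-face continuity `W (b+1) 0 = W b (n−1)`: both sides equal `[b = c ∨ b = c − 1]`
    have e1 : (b + 1 = c + 1) ↔ (b = c) := ⟨fun h => add_right_cancel h, fun h => by rw [h]⟩
    have e2 : (b + 1 = c) ↔ (b = c - 1) := ⟨fun h => by rw [← h, add_sub_cancel_right], fun h => by rw [h, sub_add_cancel]⟩
    have lhs : Wp (n := n) R c (b + 1) 0 = if b = c ∨ b = c - 1 then 1 else 0 := by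
      unfold Wp
      rw [Nat.sub_zero, qn1, q0]
      by_cases h : b + 1 = c
      · rw [if_pos h, if_pos (Or.inr (e2.1 h))]
      · rw [if_neg h]
        by_cases h' : b = c
        · rw [if_pos (e1.2 h'), if_pos (Or.inl h')]; split_ifs <;> norm_num
        · have hn1 : ¬ (b + 1 = c + 1) := fun h'' => h' (e1.1 h'')
          have hn2 : ¬ (b = c ∨ b = c - 1) := by
            rintro (h3 | h3)
            · exact h' h3
            · exact h (e2.2 h3)
          rw [if_neg hn1, if_neg hn2]; split_ifs <;> norm_num
    have rhs : Wp (n := n) R c b (n - 1) = if b = c ∨ b = c - 1 then 1 else 0 := by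
      unfold Wp
      rw [show n - 1 - (n - 1) = 0 by omega, qn1, q0]
      by_cases h : b = c
      · rw [if_pos h, if_pos (Or.inl h)]
      · rw [if_neg h]
        by_cases h' : b = c - 1
        · rw [if_pos h', if_pos (Or.inr h')]; split_ifs <;> norm_num
        · have hn2 : ¬ (b = c ∨ b = c - 1) := by
            rintro (h3 | h3)
            · exact h h3
            · exact h' h3
          rw [if_neg h', if_neg hn2]; split_ifs <;> norm_num
    rw [lhs, rhs]
  · -- flat low end `W b 1 = W b 0`
    unfold Wp
    rw [show n - 1 - 1 = n - 2 by omega, show n - 1 - 0 = n - 1 from rfl, q1, q0, qn2, qn1]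
  · -- flat high end `W b (n−1) = W b (n−2)`
    unfold Wp
    rw [show n - 1 - (n - 1) = 0 by omega, show n - 1 - (n - 2) = 1 by omega, qn1, qn2, q0, q1]

end Pieces

end Summit.QuantumFields.BalabanUV.T4Continuum.DirichletDipCutoffAxis

end
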